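import Summits.BirchSwinnertonDyer.Rank1Residual.X11b.Three.LambdaSupplyTeichmueller
import Summits.BirchSwinnertonDyer.Rank1Residual.X11b.Three.LambdaSupplyLogCoordinates
import HarnessLib

/-!
# X11b @ `p = 3`, S24-a (λ-supply), part (F-I): the TWIST CONSTRUCTION — from a continuous
# `3`-adic character `a` of a compact group with involution `θ` to finite-order twists `ω, φ′`
# such that the anti-invariant quotient of `a ω⁻¹ φ′⁻¹` is principal-unit-valued and kills
# `ker Φ₀ ∩ ker Φ₁`

HONEST FRAMING (cell `b2b-bsdres`, run/shared/lean/b2b/bsd-rank1-residual/, verbatim in every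
file): the goal of the cell is to DELETE the COMBINATION-SHAPED residual classes of the
Birch–Swinnerton-Dyer formula for ALL analytic-rank `≤ 1` elliptic curves over `ℚ` — assembled
STRICTLY from published theorems — so that the rank-`≤ 1` remainder becomes exactly the
CONSTRUCTION-SHAPED classes, which are TYPED, NOT attempted. This is not "finishing BSD". Team N8/O2
(X11b at `3`: `3 ‖ N`, `r_an = 1`, `E[3]` irreducible): research route; nothing booked; NO label
changes; O2 stays OPEN. THEOREMS ONLY (group theory + the tree's `3`-adic toolkit); no definition,
no fact, no `sorry`.

PROVENANCE: sub-target S24 'λ-SUPPLY SPLIT' (OWNERS R7-59 / R8-4 / R8-14), seat `b2b-bsdres-x11b3-p7`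
(gen. 4); census `HOME/b2b-bsdres-x11b3-p7/s24/S24-FEASIBILITY.md` step (D)/(F), QUOTIENT SHAPE.
Inputs: (D-I) `LambdaSupplyPadicUnits`, (D-II) `LambdaSupplyTeichmueller`, (D-III) `…LogCoordinates`.

## Setting and results (abstract; in (F-II) `G = Γ_K`, `θ` = complex conjugation, `Φ₀, Φ₁` = the
## `ℤ₃`-rank-two basis, `a` = Weil's avatar of the algebraic Hecke character `Ψ`, `S` = inertia at `v ∤ 3`)

`G` compact; `θ : G →ₜ* G` an involution; `Φ₀, Φ₁ : G →ₜ* ℤ₃` jointly surjective, spanning all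
continuous `G →ₜ* ℤ₃`; `N = ker Φ₀ ∩ ker Φ₁`; `F` a finite extension of `ℚ₃` (complete ultrametric
normed `ℚ₃`-algebra of finite dimension); `a : G →* Fˣ` continuous; `S ⊆ G` `θ`-stable, killed by
`a`, `Φ₀`, `Φ₁`.

* §1 small tools: `3`-power roots of unity are principal units (`norm_one_sub_lt_of_pow_three_pow`);
  a continuous character with finite image has open kernel (`isOpen_ker_of_finite_range`); DENSITY
  `range_subset_closure_image` — a continuous character trivial on the dual elements `σ₀, σ₁` takes
  all its values, up to closure, already on `N` (the closed subgroup generated by `σ₀, σ₁, N` maps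
  ONTO `ℤ₃²`, hence is `G`).
* §2 **`exists_twists`** (census (D1)+(D2)+(D3)): `ω, φ′ : G →* Fˣ` with OPEN kernels, killing
  `S`, such that for `u := a · ω⁻¹ · φ′⁻¹` the quotient `g(σ) = u(σ) · u(θσ)⁻¹` is
  PRINCIPAL-UNIT-valued and KILLS `N` (`ω` = Teichmüller part of `a`; `h = h_a/(h_a∘θ)`,
  `h_a = aω⁻¹`; `h^{3^s}(N) = 1` by log-coordinates; `φ₀ = h r₀⁻¹`, `r₀ = b₀^{Φ₀} b₁^{Φ₁}`, has
  finite image by density; `φ = φ₀ δ^{-(3^s+1)/2}`, `δ = φ₀(φ₀∘θ)`, is anti-invariant with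
  `φ|_N = h|_N`; `φ′ = φ^{(3^s+1)/2}`).

## References

* [Washington1997] L. C. Washington, *Introduction to Cyclotomic Fields*, §5.1, §13.1.
* [Greenberg1987] R. Greenberg, *Non-vanishing of certain values of `L`-functions*, §2.
-/

noncomputable section

open Filter Topology

namespace Summit.BirchSwinnertonDyer.Rank1Residual.X11b.Three.LambdaSupply.PadicUnits

open Literature.NumberTheory.Transcendental Literature.NumberTheory.Transcendental.IwasawaLog

variable {F : Type*} [NormedField F] [instF : NormedAlgebra ℚ_[3] F] [IsUltrametricDist F]

/-! ### §1. Small tools -/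

/-- **`3`-power roots of unity are principal units** (more generally: `‖x‖ = 1` and `x^{3^b}`
principal ⟹ `x` principal; `norm_one_sub_lt_of_pow_three` iterated). [cite: Serre1973, Ch. II §3.1] -/
theorem norm_one_sub_lt_of_pow_three_pow {x : F} (hx : ‖x‖ = 1) (b : ℕ) (h : ‖1 - x ^ 3 ^ b‖ < 1) :
    ‖1 - x‖ < 1 := by
  induction b generalizing x with
  | zero => simpa using h
  | succ b ih =>
    rw [pow_succ', pow_mul] at h
    exact norm_one_sub_lt_of_pow_three hx (ih (by rw [norm_pow, hx, one_pow]) h)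

omit instF [IsUltrametricDist F] in
/-- **A continuous character with finite image has open kernel.** [folklore] -/
theorem isOpen_ker_of_finite_range {G : Type*} [Group G] [TopologicalSpace G] (f : G →* Fˣ)
    (hf : Continuous f) (hfin : (Set.range f).Finite) : IsOpen (f.ker : Set G) := by
  have hclosed : IsClosed (Set.range f \ {1}) := (hfin.subset fun x hx => hx.1).isClosed
  have : (f.ker : Set G) = f ⁻¹' (Set.range f \ {1})ᶜ := by
    ext σ
    simp only [SetLike.mem_coe, MonoidHom.mem_ker, Set.mem_preimage, Set.mem_compl_iff]
    constructor
    · intro h hm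
      exact hm.2 h
    · intro h
      by_contra hne
      exact h ⟨⟨σ, rfl⟩, hne⟩
  rw [this]
  exact hclosed.isOpen_compl.preimage hf

omit instF [IsUltrametricDist F] in
/-- A homomorphism of topological groups with open kernel is continuous (locally constant).
[folklore] -/
theorem continuous_of_isOpen_ker' {G : Type*} [Group G] [TopologicalSpace G] [IsTopologicalGroup G]
    (f : G →* Fˣ) (hf : IsOpen (f.ker : Set G)) : Continuous f := by
  refine continuous_of_continuousAt_one f ?_
  rw [ContinuousAt, map_one]
  refine Filter.tendsto_def.mpr fun W hW => Filter.mem_of_superset (hf.mem_nhds f.ker.one_mem) ?_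
  intro x hx
  rw [Set.mem_preimage, (MonoidHom.mem_ker).mp hx]
  exact mem_of_mem_nhds hW

omit instF [IsUltrametricDist F] in
/-- **Density of `⟨σ₀, σ₁⟩ · N`.** Let `G` be a compact group, `Φ₀, Φ₁ : G →ₜ* ℤ_p` with
`Φⱼ(σᵢ) = δᵢⱼ`, and `f : G →* Fˣ` continuous with `f σ₀ = f σ₁ = 1`. Then every value of `f` is
already a value on `N = ker Φ₀ ∩ ker Φ₁`, up to closure: `range f ⊆ closure (f '' N)`. Indeed the
CLOSED subgroup `D` generated by `σ₀, σ₁, N` maps onto a compact subset of `ℤ_p²` containing the dense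
`ℕ²`, so `Φ(D) = ℤ_p²` and `D = G`; and `f(D) ⊆ closure f(⟨σ₀,σ₁,N⟩) = closure f(N)`. [folklore] -/
theorem range_subset_closure_image {p : ℕ} [Fact p.Prime] {G : Type*} [Group G] [TopologicalSpace G]
    [IsTopologicalGroup G] [CompactSpace G] (Φ₀ Φ₁ : G →ₜ* Multiplicative ℤ_[p]) {σ₀ σ₁ : G}
    (h₀₀ : (Φ₀ σ₀).toAdd = 1) (h₀₁ : (Φ₁ σ₀).toAdd = 0) (h₁₀ : (Φ₀ σ₁).toAdd = 0)
    (h₁₁ : (Φ₁ σ₁).toAdd = 1) (f : G →* Fˣ) (hf : Continuous f) (hf₀ : f σ₀ = 1) (hf₁ : f σ₁ = 1) :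
    Set.range f ⊆ closure (f '' {σ | Φ₀ σ = 1 ∧ Φ₁ σ = 1}) := by
  classical
  -- `N` as a subgroup and the closed subgroup `D`
  let N : Subgroup G := Φ₀.toMonoidHom.ker ⊓ Φ₁.toMonoidHom.ker
  have hNmem : ∀ σ, σ ∈ N ↔ Φ₀ σ = 1 ∧ Φ₁ σ = 1 := fun σ => by
    simp only [N, Subgroup.mem_inf, MonoidHom.mem_ker]; rfl
  let D₀ : Subgroup G := Subgroup.closure ({σ₀, σ₁} ∪ (N : Set G))
  let D : Subgroup G := D₀.topologicalClosure
  -- the coordinates `Φ = (Φ₀, Φ₁)`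
  let Φ : G → ℤ_[p] × ℤ_[p] := fun σ => ((Φ₀ σ).toAdd, (Φ₁ σ).toAdd)
  have hΦc : Continuous Φ :=
    (continuous_toAdd.comp Φ₀.continuous).prodMk (continuous_toAdd.comp Φ₁.continuous)
  have hΦmul : ∀ σ τ, Φ (σ * τ) = Φ σ + Φ τ := fun σ τ => by
    simp only [Φ, map_mul, toAdd_mul, Prod.mk_add_mk]
  -- `Φ(D) ⊇ ℕ²`
  have hpow : ∀ n m : ℕ, σ₀ ^ n * σ₁ ^ m ∈ D := fun n m =>
    D₀.le_topologicalClosure (D₀.mul_mem (D₀.pow_mem (Subgroup.subset_closure (by simp)) n)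
      (D₀.pow_mem (Subgroup.subset_closure (by simp)) m))
  have hΦpow : ∀ n m : ℕ, Φ (σ₀ ^ n * σ₁ ^ m) = ((n : ℤ_[p]), (m : ℤ_[p])) := fun n m => by
    rw [hΦmul]
    simp only [Φ, map_pow, toAdd_pow, h₀₀, h₀₁, h₁₀, h₁₁, mul_one, mul_zero,
      Prod.mk_add_mk, add_zero, zero_add, nsmul_eq_mul]
  -- `Φ(D)` is closed and contains a dense set, hence everything
  have hDc : IsClosed (D : Set G) := D₀.isClosed_topologicalClosure
  have hΦD : IsClosed (Φ '' (D : Set G)) := (hDc.isCompact.image hΦc).isClosed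
  have hdense : Dense (Φ '' (D : Set G)) := by
    have hd : DenseRange (fun nm : ℕ × ℕ => ((nm.1 : ℤ_[p]), (nm.2 : ℤ_[p]))) :=
      PadicInt.denseRange_natCast.prodMap PadicInt.denseRange_natCast
    refine hd.mono ?_
    rintro _ ⟨⟨n, m⟩, rfl⟩
    exact ⟨σ₀ ^ n * σ₁ ^ m, hpow n m, hΦpow n m⟩
  have hΦD' : Φ '' (D : Set G) = Set.univ := by
    rw [← hdense.closure_eq, hΦD.closure_eq]
  -- hence `D = G`
  have hD : ∀ τ, τ ∈ D := fun τ => by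
    obtain ⟨d, hd, hdτ⟩ : Φ τ ∈ Φ '' (D : Set G) := by rw [hΦD']; exact Set.mem_univ _
    have hn : d⁻¹ * τ ∈ N := by
      rw [hNmem]
      have h1 : Φ (d⁻¹ * τ) = 0 := by
        have := hΦmul d (d⁻¹ * τ)
        rw [mul_inv_cancel_left, hdτ] at this
        exact (add_eq_left.mp this.symm)
      simp only [Φ, Prod.mk_eq_zero] at h1
      exact ⟨Multiplicative.toAdd.injective (by rw [toAdd_one]; exact h1.1),
        Multiplicative.toAdd.injective (by rw [toAdd_one]; exact h1.2)⟩
    have hnD : d⁻¹ * τ ∈ D :=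
      D₀.le_topologicalClosure (Subgroup.subset_closure (Set.mem_union_right _ hn))
    have := D.mul_mem hd hnD
    rwa [mul_inv_cancel_left] at this
  -- `f(D₀) ⊆ f(N)` and `f(D) ⊆ closure f(N)`
  have hfD₀ : ∀ σ ∈ D₀, f σ ∈ (N.map f : Set Fˣ) := by
    intro σ hσ
    have hle : D₀ ≤ (N.map f).comap f := by
      rw [Subgroup.closure_le]
      rintro τ (hτ | hτ)
      · rcases hτ with rfl | hτ
        · exact Subgroup.mem_comap.mpr (by rw [hf₀]; exact (N.map f).one_mem)
        · rw [Set.mem_singleton_iff] at hτ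
          subst hτ
          exact Subgroup.mem_comap.mpr (by rw [hf₁]; exact (N.map f).one_mem)
      · exact Subgroup.mem_comap.mpr (Subgroup.mem_map_of_mem f hτ)
    exact hle hσ
  have himage : f '' (D : Set G) ⊆ closure (f '' (N : Set G)) := by
    have h1 : f '' (D : Set G) ⊆ closure (f '' (D₀ : Set G)) := by
      rw [show (D : Set G) = closure (D₀ : Set G) from Subgroup.topologicalClosure_coe]
      exact image_closure_subset_closure_image hf
    refine h1.trans (closure_mono ?_)
    rintro _ ⟨σ, hσ, rfl⟩
    exact hfD₀ σ hσ
  rintro _ ⟨τ, rfl⟩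
  have hN' : (N : Set G) = {σ | Φ₀ σ = 1 ∧ Φ₁ σ = 1} := Set.ext fun σ => hNmem σ
  rw [← hN']
  exact himage ⟨τ, hD τ, rfl⟩

/-! ### §2. The twist construction -/

section Twist

variable [CompleteSpace F] [FiniteDimensional ℚ_[3] F]
variable {G : Type*} [Group G] [TopologicalSpace G] [IsTopologicalGroup G] [CompactSpace G]

include instF in
/-- **The twists (census (D1)+(D2)+(D3)).** In the setting of the module docstring there are
`ω, φ′ : G →* Fˣ` with open kernels, killing `S`, such that for `u = a ω⁻¹ φ′⁻¹` the anti-invariant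
quotient `σ ↦ u(σ) u(θσ)⁻¹` is principal-unit-valued and kills `N = ker Φ₀ ∩ ker Φ₁`.
[cite: Washington1997, §5.1] [cite: Greenberg1987, §2] -/
theorem exists_twists (θ : G →ₜ* G) (hθθ : ∀ σ, θ (θ σ) = σ)
    (Φ₀ Φ₁ : G →ₜ* Multiplicative ℤ_[3])
    (hsurj : Function.Surjective fun σ => ((Φ₀ σ).toAdd, (Φ₁ σ).toAdd))
    (hspan : ∀ f : G →ₜ* Multiplicative ℤ_[3], ∃ c₀ c₁ : ℤ_[3],
      ∀ σ, (f σ).toAdd = c₀ * (Φ₀ σ).toAdd + c₁ * (Φ₁ σ).toAdd)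
    (a : G →* Fˣ) (ha : Continuous a) (S : Set G) (hSθ : ∀ σ ∈ S, θ σ ∈ S)
    (haS : ∀ σ ∈ S, a σ = 1) (hΦS : ∀ σ ∈ S, Φ₀ σ = 1 ∧ Φ₁ σ = 1) :
    ∃ ω φ' : G →* Fˣ, IsOpen (ω.ker : Set G) ∧ IsOpen (φ'.ker : Set G) ∧
      (∀ σ ∈ S, ω σ = 1) ∧ (∀ σ ∈ S, φ' σ = 1) ∧
      (∀ σ, Φ₀ σ = 1 → Φ₁ σ = 1 →
        (a * ω⁻¹ * φ'⁻¹) σ * ((a * ω⁻¹ * φ'⁻¹) (θ σ))⁻¹ = 1) ∧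
      ∀ σ, ‖1 - (((a * ω⁻¹ * φ'⁻¹) σ * ((a * ω⁻¹ * φ'⁻¹) (θ σ))⁻¹ : Fˣ) : F)‖ < 1 := by
  obtain ⟨P, hP⟩ := exists_principalUnits (F := F)
  have hPmul : ∀ {x y : Fˣ}, x ∈ P → y ∈ P → x * y ∈ P := fun hx hy => P.mul_mem hx hy
  have hPinv : ∀ {x : Fˣ}, x ∈ P → x⁻¹ ∈ P := fun hx => P.inv_mem hx
  -- `θ` preserves `N`
  have hθN : ∀ σ, Φ₀ σ = 1 → Φ₁ σ = 1 → Φ₀ (θ σ) = 1 ∧ Φ₁ (θ σ) = 1 := by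
    intro σ h0 h1
    obtain ⟨c₀, c₁, hc⟩ := hspan (Φ₀.comp θ)
    obtain ⟨d₀, d₁, hd⟩ := hspan (Φ₁.comp θ)
    have e0' : (Φ₀.comp θ σ).toAdd = _ := hc σ
    have e1' : (Φ₁.comp θ σ).toAdd = _ := hd σ
    rw [h0, h1, toAdd_one, mul_zero, mul_zero, add_zero] at e0' e1'
    exact ⟨Multiplicative.toAdd.injective (by rw [toAdd_one]; exact e0'),
      Multiplicative.toAdd.injective (by rw [toAdd_one]; exact e1')⟩
  -- Step 1: the Teichmüller part `ω` of `a`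
  obtain ⟨T, hT, hT3, haT⟩ := exists_pow_mem_principalUnits_coprime_three a ha P hP
  obtain ⟨ω, hωT, haω, hωP⟩ := exists_teichmueller_splitting (p := 3) a P hP hT hT3 haT
  have hωS : ∀ σ ∈ S, ω σ = 1 := fun σ hσ => hωP σ (by rw [haS σ hσ]; exact P.one_mem)
  have hωker : IsOpen (ω.ker : Set G) := by
    -- `ker ω ⊇ a⁻¹(P)`, an open subgroup
    have hPo : IsOpen (P : Set Fˣ) := by
      have : (P : Set Fˣ) = {u : Fˣ | ‖1 - (u : F)‖ < 1} := Set.ext fun u => hP u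
      rw [this]; exact isOpen_setOf_norm_one_sub_lt
    exact Subgroup.isOpen_mono (H₁ := P.comap a) (fun σ hσ => hωP σ hσ) (hPo.preimage ha)
  have hωc : Continuous ω := continuous_of_isOpen_ker' ω hωker
  -- Step 2: `h_a = a ω⁻¹` and the anti-invariant `h = h_a / (h_a ∘ θ)`
  set hA : G →* Fˣ := a * ω⁻¹ with hhA
  have hhA_P : ∀ σ, hA σ ∈ P := fun σ => haω σ
  have hhA_c : Continuous hA := by
    show Continuous fun σ => (a * ω⁻¹) σ
    simp only [MonoidHom.mul_apply, MonoidHom.inv_apply]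
    exact ha.mul hωc.inv
  have hhA_S : ∀ σ ∈ S, hA σ = 1 := fun σ hσ => by
    simp only [hhA, MonoidHom.mul_apply, MonoidHom.inv_apply, haS σ hσ, hωS σ hσ, inv_one, mul_one]
  set h : G →* Fˣ := hA * (hA.comp θ.toMonoidHom)⁻¹ with hh
  have hh_apply : ∀ σ, h σ = hA σ * (hA (θ σ))⁻¹ := fun σ => rfl
  have hh_P : ∀ σ, h σ ∈ P := fun σ => hPmul (hhA_P σ) (hPinv (hhA_P _))
  have hh_P' : ∀ σ, ‖1 - ((h σ : Fˣ) : F)‖ < 1 := fun σ => (hP _).mp (hh_P σ)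
  have hh_c : Continuous h := by
    show Continuous fun σ => h σ
    simp only [hh_apply]
    exact hhA_c.mul (hhA_c.comp θ.continuous).inv
  have hh_S : ∀ σ ∈ S, h σ = 1 := fun σ hσ => by
    rw [hh_apply, hhA_S σ hσ, hhA_S _ (hSθ σ hσ), inv_one, mul_one]
  have hh_anti : ∀ σ, h (θ σ) = (h σ)⁻¹ := fun σ => by
    rw [hh_apply, hh_apply, hθθ, mul_inv_rev, inv_inv]
  -- Step 3: `h^{3^s}` kills `N`
  obtain ⟨M, hM, hMN⟩ := pow_eq_one_of_forall_character (p := 3) (F := F) Φ₀ Φ₁ hspan h hh_c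
  obtain ⟨s, m, hm3, rfl⟩ := Nat.exists_eq_pow_mul_and_not_dvd hM.ne' 3 (by norm_num)
  have hm : (3 : ℕ).Coprime m := (Nat.Prime.coprime_iff_not_dvd Nat.prime_three).mpr hm3
  have hsN : ∀ σ, Φ₀ σ = 1 → Φ₁ σ = 1 → (h σ) ^ 3 ^ s = 1 := by
    intro σ h0 h1
    have hy : ‖1 - (((h σ) ^ 3 ^ s : Fˣ) : F)‖ < 1 := (hP _).mp (P.pow_mem (hh_P σ) _)
    have hym : ((((h σ) ^ 3 ^ s : Fˣ) : F)) ^ m = 1 := by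
      rw [← Units.val_pow_eq_pow_val, ← pow_mul, hMN σ h0 h1, Units.val_one]
    exact Units.ext (eq_one_of_pow_eq_one_of_coprime (p := 3) hy hm hym)
  -- Step 4: dual elements and `r₀(σ) = b₀^{Φ₀ σ} b₁^{Φ₁ σ}`
  obtain ⟨σ₀, hσ₀⟩ := hsurj (1, 0)
  obtain ⟨σ₁, hσ₁⟩ := hsurj (0, 1)
  simp only [Prod.mk.injEq] at hσ₀ hσ₁
  obtain ⟨χ₀, hχ₀c, hχ₀1, hχ₀P⟩ := exists_zpPow (p := 3) (hh_P' σ₀)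
  obtain ⟨χ₁, hχ₁c, hχ₁1, hχ₁P⟩ := exists_zpPow (p := 3) (hh_P' σ₁)
  set r₀ : G →* Fˣ := (χ₀.comp Φ₀.toMonoidHom) * (χ₁.comp Φ₁.toMonoidHom) with hr₀
  have hr₀_apply : ∀ σ, r₀ σ = χ₀ (Φ₀ σ) * χ₁ (Φ₁ σ) := fun σ => rfl
  have hr₀_c : Continuous r₀ := by
    show Continuous fun σ => r₀ σ
    simp only [hr₀_apply]
    exact (hχ₀c.comp Φ₀.continuous).mul (hχ₁c.comp Φ₁.continuous)
  have hr₀_N : ∀ σ, Φ₀ σ = 1 → Φ₁ σ = 1 → r₀ σ = 1 := fun σ h0 h1 => by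
    rw [hr₀_apply, h0, h1, map_one, map_one, mul_one]
  have hr₀_S : ∀ σ ∈ S, r₀ σ = 1 := fun σ hσ => hr₀_N σ (hΦS σ hσ).1 (hΦS σ hσ).2
  have hr₀_P : ∀ σ, r₀ σ ∈ P := fun σ => by
    rw [hr₀_apply]
    refine hPmul ((hP _).mpr ((hχ₀P _).trans_lt (hh_P' σ₀))) ((hP _).mpr ((hχ₁P _).trans_lt (hh_P' σ₁)))
  have hr₀σ₀ : r₀ σ₀ = h σ₀ := by
    apply Units.ext
    rw [hr₀_apply, Units.val_mul, show Φ₀ σ₀ = Multiplicative.ofAdd 1 from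
      Multiplicative.toAdd.injective (by rw [toAdd_ofAdd]; exact hσ₀.1), hχ₀1,
      show Φ₁ σ₀ = 1 from Multiplicative.toAdd.injective (by rw [toAdd_one]; exact hσ₀.2), map_one,
      Units.val_one, mul_one]
  have hr₀σ₁ : r₀ σ₁ = h σ₁ := by
    apply Units.ext
    rw [hr₀_apply, Units.val_mul, show Φ₀ σ₁ = 1 from
      Multiplicative.toAdd.injective (by rw [toAdd_one]; exact hσ₁.1), map_one, Units.val_one, one_mul,
      show Φ₁ σ₁ = Multiplicative.ofAdd 1 from Multiplicative.toAdd.injective (by rw [toAdd_ofAdd]; exact hσ₁.2),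
      hχ₁1]
  -- Step 5: `φ₀ = h r₀⁻¹` has finite image `⊆ h(N) ⊆ μ_{3^s}`
  set φ₀ : G →* Fˣ := h * r₀⁻¹ with hφ₀
  have hφ₀_apply : ∀ σ, φ₀ σ = h σ * (r₀ σ)⁻¹ := fun σ => rfl
  have hφ₀_c : Continuous φ₀ := by
    show Continuous fun σ => φ₀ σ
    simp only [hφ₀_apply]
    exact hh_c.mul hr₀_c.inv
  have hφ₀_N : ∀ σ, Φ₀ σ = 1 → Φ₁ σ = 1 → φ₀ σ = h σ := fun σ h0 h1 => by
    rw [hφ₀_apply, hr₀_N σ h0 h1, inv_one, mul_one]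
  -- the finite set of `3^s`-th roots of unity in `Fˣ`
  set R : Set Fˣ := {x | x ^ 3 ^ s = 1} with hR
  have hRfin : R.Finite := by
    have hinj : Set.InjOn (fun x : Fˣ => (x : F)) R := fun x _ y _ hxy => Units.ext hxy
    refine Set.Finite.of_finite_image ?_ hinj
    refine (Multiset.finite_toSet (Polynomial.nthRoots (3 ^ s) (1 : F))).subset ?_
    rintro _ ⟨x, hx, rfl⟩
    simp only [Set.mem_setOf_eq, hR] at hx
    simp only [Set.mem_setOf_eq]
    exact (Polynomial.mem_nthRoots (pow_pos (by norm_num) _)).mpr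
      (by rw [← Units.val_pow_eq_pow_val, hx, Units.val_one])
  have hRclosed : IsClosed R := hRfin.isClosed
  have hφ₀_range : ∀ τ, φ₀ τ ∈ R := by
    intro τ
    have hsub := range_subset_closure_image (p := 3) Φ₀ Φ₁ hσ₀.1 hσ₀.2 hσ₁.1 hσ₁.2 φ₀ hφ₀_c
      (by rw [hφ₀_apply, hr₀σ₀, mul_inv_cancel]) (by rw [hφ₀_apply, hr₀σ₁, mul_inv_cancel])
    have himR : φ₀ '' {σ | Φ₀ σ = 1 ∧ Φ₁ σ = 1} ⊆ R := by
      rintro _ ⟨σ, ⟨h0, h1⟩, rfl⟩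
      show φ₀ σ ^ 3 ^ s = 1
      rw [hφ₀_N σ h0 h1, hsN σ h0 h1]
    exact (hRclosed.closure_subset_iff.mpr himR) (hsub ⟨τ, rfl⟩)
  have hφ₀_pow : ∀ τ, φ₀ τ ^ 3 ^ s = 1 := fun τ => hφ₀_range τ
  have hφ₀_S : ∀ σ ∈ S, φ₀ σ = 1 := fun σ hσ => by
    rw [hφ₀_apply, hh_S σ hσ, hr₀_S σ hσ, inv_one, mul_one]
  -- Step 6: anti-invariantisation. `δ = φ₀ (φ₀∘θ)` is `θ`-invariant and `3^s`-torsion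
  set n : ℕ := (3 ^ s + 1) / 2 with hn
  have hodd : Odd (3 ^ s) := Odd.pow (by decide)
  have h2n : 2 * n = 3 ^ s + 1 := Nat.two_mul_div_two_of_even (hodd.add_one)
  set φθ : G →* Fˣ := φ₀.comp θ.toMonoidHom with hφθ
  set δ : G →* Fˣ := φ₀ * φθ with hδ
  set ε : G →* Fˣ := (powMonoidHom n).comp δ with hε
  set φ : G →* Fˣ := φ₀ * ε⁻¹ with hφ
  have hφ_apply : ∀ σ, φ σ = φ₀ σ * ((φ₀ σ * φ₀ (θ σ)) ^ n)⁻¹ := fun σ => rfl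
  set φ' : G →* Fˣ := (powMonoidHom n).comp φ with hφ'
  have hφ'_apply : ∀ σ, φ' σ = (φ σ) ^ n := fun σ => rfl
  -- torsion bookkeeping: everything is `3^s`-torsion
  have hδ_pow : ∀ τ, (φ₀ τ * φ₀ (θ τ)) ^ 3 ^ s = 1 := fun τ => by
    rw [mul_pow, hφ₀_pow, hφ₀_pow, one_mul]
  have hφ_pow : ∀ τ, φ τ ^ 3 ^ s = 1 := fun τ => by
    rw [hφ_apply, mul_pow, inv_pow, ← pow_mul, mul_comm (n : ℕ), pow_mul, hδ_pow, one_pow, inv_one,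
      mul_one, hφ₀_pow]
  -- `φ` is anti-invariant
  have hφ_anti : ∀ τ, φ τ * φ (θ τ) = 1 := fun τ => by
    rw [hφ_apply, hφ_apply, hθθ, mul_comm (φ₀ (θ τ)) (φ₀ τ)]
    -- φ₀τ · d⁻ⁿ · φ₀(θτ) · d⁻ⁿ = d · (d^{2n})⁻¹ = d · (d^{3^s} · d)⁻¹ = 1, d = φ₀τ φ₀(θτ)
    have hd := hδ_pow τ
    rw [mul_mul_mul_comm, ← mul_inv, ← pow_add, ← two_mul, h2n, pow_succ, hd, one_mul,
      mul_inv_cancel]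
  -- `φ` agrees with `h` on `N`
  have hφ_N : ∀ σ, Φ₀ σ = 1 → Φ₁ σ = 1 → φ σ = h σ := fun σ h0 h1 => by
    obtain ⟨h0', h1'⟩ := hθN σ h0 h1
    rw [hφ_apply, hφ₀_N σ h0 h1, hφ₀_N _ h0' h1', hh_anti, mul_inv_cancel, one_pow, inv_one, mul_one]
  -- `φ' / (φ'∘θ) = φ`
  have hφ'_quot : ∀ τ, φ' τ * (φ' (θ τ))⁻¹ = φ τ := fun τ => by
    rw [hφ'_apply, hφ'_apply]
    have hinv : φ (θ τ) = (φ τ)⁻¹ := eq_inv_of_mul_eq_one_right (hφ_anti τ)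
    rw [hinv, inv_pow, inv_inv, ← pow_add, ← two_mul, h2n, pow_succ, hφ_pow, one_mul]
  -- values of `φ₀, φ, φ'` are principal units (3-power roots of unity are)
  have hφ_P : ∀ τ, φ τ ∈ P := fun τ => by
    rw [hP]
    have h1 : ‖((φ τ : Fˣ) : F)‖ = 1 := by
      have := congrArg (fun x : Fˣ => ‖(x : F)‖) (hφ_pow τ)
      simp only [Units.val_pow_eq_pow_val, norm_pow, Units.val_one, norm_one] at this
      exact (pow_eq_one_iff_of_nonneg (norm_nonneg _) (pow_ne_zero _ (by norm_num))).mp this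
    exact norm_one_sub_lt_of_pow_three_pow h1 s (by
      rw [← Units.val_pow_eq_pow_val, hφ_pow, Units.val_one, sub_self, norm_zero]; exact one_pos)
  -- `S` is killed by everything
  have hφθ_S : ∀ σ ∈ S, φ₀ (θ σ) = 1 := fun σ hσ => hφ₀_S _ (hSθ σ hσ)
  have hφ_S : ∀ σ ∈ S, φ σ = 1 := fun σ hσ => by
    simp only [hφ_apply, hφ₀_S σ hσ, hφθ_S σ hσ, one_mul, one_pow, inv_one]
  have hφ'_S : ∀ σ ∈ S, φ' σ = 1 := fun σ hσ => by rw [hφ'_apply, hφ_S σ hσ, one_pow]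
  -- continuity and open kernels (finite images inside `R`)
  have hφ'_c : Continuous φ' := by
    show Continuous fun σ => φ' σ
    simp only [hφ'_apply, hφ_apply]
    exact ((hφ₀_c.mul (((hφ₀_c.mul (hφ₀_c.comp θ.continuous)).pow n).inv)).pow n)
  have hφ'_range : (Set.range φ').Finite := by
    refine hRfin.subset ?_
    rintro _ ⟨τ, rfl⟩
    show φ' τ ^ 3 ^ s = 1
    rw [hφ'_apply, ← pow_mul, mul_comm, pow_mul, hφ_pow, one_pow]
  have hφ'_ker : IsOpen (φ'.ker : Set G) := isOpen_ker_of_finite_range φ' hφ'_c hφ'_range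
  -- Step 7: conclude with `u = a ω⁻¹ φ'⁻¹ = h_a φ'⁻¹` and `g = u/(u∘θ) = h φ⁻¹`
  have hu : ∀ σ, (a * ω⁻¹ * φ'⁻¹) σ * ((a * ω⁻¹ * φ'⁻¹) (θ σ))⁻¹ = h σ * (φ σ)⁻¹ := fun σ => by
    rw [← hφ'_quot σ, hh_apply σ]
    change (hA σ * (φ' σ)⁻¹) * (hA (θ σ) * (φ' (θ σ))⁻¹)⁻¹ = _
    simp only [mul_inv_rev, inv_inv, mul_assoc, mul_comm, mul_left_comm]
  refine ⟨ω, φ', hωker, hφ'_ker, hωS, hφ'_S, fun σ h0 h1 => ?_, fun σ => ?_⟩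
  · rw [hu, hφ_N σ h0 h1, mul_inv_cancel]
  · rw [hu]
    exact (hP _).mp (hPmul (hh_P σ) (hPinv (hφ_P σ)))

end Twist

end Summit.BirchSwinnertonDyer.Rank1Residual.X11b.Three.LambdaSupply.PadicUnits

end
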